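import Literature.MathematicalPhysics.QuantumFieldTheory.BalabanImbrieJaffe1984to88.BIJ88Sect2Statements

/-!
# `BalabanImbrieJaffe1984to88.BIJ88Eq220Proof` — T. Bałaban, J. Imbrie, A. Jaffe, *Effective action and cluster properties
of the abelian Higgs model*, Commun. Math. Phys. **114** (1988) 257–315 [BalabanImbrieJaffe1988]: (2.20)–(2.22) p. 262 — the
kernel generating the gauge transformation, `(Q^{s*}_k − 𝒟_k∂*Q^{e*}_k∂)A = H_kA + ∂C_kA` with
`C_k = D_k + Σ_{j<k} D_jC^{(j)}H*_j∂*Q^{e*}_k∂`, DERIVED as the print derives it (*"by changing gauge in each term in the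
hierarchical sum defining 𝒟_k and applying (I.5.3.1)"*), as operator algebra

statement-level skeleton of published theorems with citation tags; proofs where landed; nothing here is a claim about the Yang–Mills mass gap

PDF held: `paper:balaban1988-cmp114-bij-abelian-higgs-effective-action` (journal page = PDF page + 256), p. 262 [PDF 6];
(I) = [BalabanImbrieJaffe1985] (`paper:balaban1985-cmp97-bij-higgs-minimizers`): Prop. 5.1.1 (5.1.1) p. 313 [PDF 15], Prop. 5.2.2
(5.2.6)–(5.2.7) p. 316 [PDF 18], (5.3.1) p. 317 [PDF 19] (text layer, re-read this session).

WHAT IS REPRODUCED.  SKELETON rows **C2.Eq2.20** (IDENTITY, the bare `def … : Prop` `BIJ88Sect2Statements.Eq220`, typed p239939),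
**C2.Eq2.21** (`BIJ88Sect2Statements.Eq221` = (I.5.1.1)) and **C2.Eq2.22** (DEF `BIJ88Sect2Statements.cK`) (cell `lit-balaban`;
Phase-2 seat p02 gen 2 = unit `lit-balaban-p02`; C2 §§1–4 fold owner r18, referee ref-5; TAKING line HOME/STATUS.md
2026-08-21T03:58:58Z).
p. 262, verbatim: *"Another important kernel is the one generating the gauge transformation: (Q^{s*}_k − 𝒟_k∂*Q^{e*}_k∂)A =
H_kA + ∂C_kA. (2.20) The kernel C_k is constructed from the basic gauge transformation D_k which changes the minimizer from axial
to Landau gauge (I.5.1.1): H_{k,Ax}B = H_kB + ∂D_kB. (2.21) By changing gauge in each term in the hierarchical sum defining 𝒟_k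
and applying (I.5.3.1), we obtain C_k = D_k + Σ_{j=0}^{k−1} D^{L^jη}_jC^{(j),L^jη}H^{*L^jη}_j∂*Q^{e*}_k∂. (2.22)"*.  The inputs,
verbatim: (I) p. 317 *"H_{k,Ax}B = Q^{s*}_kB − G_{k,Ax}∂*Q^{e*}_k∂B. (5.3.1)"*; (I) p. 313 *"H_{k,Ax}B − H_kB = ∂λ. (5.1.1) We show
that λ is an explicit, linear function of H_kB"* (so `λ = D_kB`, (2.21)); (I) p. 316 *"Proposition 5.2.2. There is a gauge
transformation D such that G_{k,Ax}∂* − 𝒟_k∂* = ∂D. (5.2.6) Explicitly D = Σ_{j=0}^{k−1} λ_j(H_jC^{(j)}H*_j∂*), (5.2.7) where λ_j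
is the function of Proposition 5.1.1 with k set equal to j"* (so, by (2.21) at scale j applied to the configuration
`B = C^{(j)}H*_j∂*J`, `D = Σ_{j<k} D_jC^{(j)}H*_j∂*` — the hypothesis `h527` below); (I) p. 312 *"𝒟_k ≡ Σ_{j=0}^{k−1} H_jC^{(j)}H*_j.
(4.4.4)"* (`BIJ85Sect4Statements.curlyD`).

WHAT IS PROVED HERE (0 `sorry`, standard axioms; kind «knitting identity»).  In a ring of operators (the typing of record of
(2.9)–(2.22); `ds` = ∂*, `Qest` = Q^{e*}_k, `Qsst` = Q^{s*}_k, `GAx` = G_{k,Ax}, `cDk` = 𝒟_k, `HAx` = H_{k,Ax}, `Hk` = H_k,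
`Dk` = D_k, `D` = the D of (I.5.2.6)):
* `eq221_iff_sub` — (2.21) ⇔ (I.5.1.1) `H_{k,Ax} − H_k = ∂D_k`;
* **`eq220_of_526`** — (2.20) with `C_k = D_k + D·Q^{e*}_k∂` from (I.5.3.1) `h531`, (2.21) `h221` and (I.5.2.6) `h526`: the
  three-line computation `Q^{s*} − 𝒟∂*Q^{e*}∂ = H_{Ax} + (G_{Ax}∂* − 𝒟∂*)Q^{e*}∂ = H_k + ∂D_k + ∂DQ^{e*}∂`;
* **`eq220`** — (2.20) with `C_k` = **(2.22)** `BIJ88Sect2Statements.cK D_k D C H* (∂*Q^{e*}_k∂) k`, adding (I.5.2.7) in the form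
  `h527 : D = Σ_{j<k} D_jC^{(j)}H*_j∂*` (`curlyD_mul_right` moves the factor `Q^{e*}_k∂` inside the hierarchical sum);
* `eq220_unique` — conversely, (2.20) determines `∂C_k`: any two kernels satisfying (2.20) have the same gradient part;
* `eq221_gaugeRG` — (2.21) on r15's carrier `BIJ85Sect4Statements.GaugeRG` with `D_kB := λ` of (I.5.1.4) (`lam514`), from
  Prop. I.5.1.1 (`Prop511`), pointwise.
HONEST SCOPE.  The typing of record uses ONE ring element `d` both for the gradient ∂ (gauge functions → bond fields: `∂C_kA`,
`∂D_kB`, `∂D`) and for the exterior derivative ∂ (bond fields → plaquette fields: `Q^{e*}_k∂`); this is sound for operators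
extended by zero on the graded space Ω⁰ ⊕ Ω¹ ⊕ Ω² with `d` the total differential, and the hypotheses below inherit exactly that
reading.  (I.5.3.1), (I.5.1.1), (I.5.2.6)–(I.5.2.7) enter as hypotheses (their tree forms: `BIJ85Eq531Proof.eq531_torus`,
`BIJ85Sect4Statements.GaugeRG.Prop511`, `BIJ85Sect4Statements.Prop522Data.Prop522` / `BIJ85Prop522Proof.prop522_holds`); the
lattice superscripts `L^jη` of (2.22) are the instance's.  Nothing on the decay (2.23)–(2.26), on d = 4 or the continuum; NOT
summit progress.
-/

namespace Literature.MathematicalPhysics.QuantumFieldTheory.BalabanImbrieJaffe1984to88.BIJ88Eq220Proof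

open Finset BIJ88Sect2Statements BIJ85Sect4Statements

/-! ## §1  (2.20)–(2.22) in a ring of operators -/

section RingLevel

variable {R : Type*} [Ring R]

/-- **(2.21)** ⇔ (I.5.1.1): `H_{k,Ax} = H_k + ∂D_k` iff `H_{k,Ax} − H_k = ∂D_k` (*"H_{k,Ax}B − H_kB = ∂λ. (5.1.1)"*, `λ = D_kB`).
[cite: BalabanImbrieJaffe1988, (2.21) p.262] -/
theorem eq221_iff_sub (HAx Hk d Dk : R) : Eq221 HAx Hk d Dk ↔ HAx - Hk = d * Dk := by
  unfold Eq221
  rw [sub_eq_iff_eq_add']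

/-- The factor `Q^{e*}_k∂` moves inside the hierarchical sum: `(Σ_{j<k} D_jC^{(j)}(H*_j∂*))·Y = Σ_{j<k} D_jC^{(j)}(H*_j∂*Y)`
(`BIJ85Sect4Statements.curlyD`, (I.4.4.4)). [cite: BalabanImbrieJaffe1988, (2.22) p.262] -/
theorem curlyD_mul_right (D C Hs : ℕ → R) (Y : R) (k : ℕ) :
    curlyD D C Hs k * Y = curlyD D C (fun j => Hs j * Y) k := by
  unfold curlyD
  rw [sum_mul]
  refine sum_congr rfl fun j _ => ?_
  simp only [mul_assoc]

/-- **(2.20) with `C_k = D_k + DQ^{e*}_k∂`** — the printed change of gauge, as ring algebra: from (I.5.3.1)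
`H_{k,Ax} = Q^{s*}_k − G_{k,Ax}∂*Q^{e*}_k∂` (`h531`), (2.21) `H_{k,Ax} = H_k + ∂D_k` (`h221`) and (I.5.2.6)
`G_{k,Ax}∂* − 𝒟_k∂* = ∂D` (`h526`):
`Q^{s*}_k − 𝒟_k∂*Q^{e*}_k∂ = H_{k,Ax} + (G_{k,Ax}∂* − 𝒟_k∂*)Q^{e*}_k∂ = H_k + ∂(D_k + DQ^{e*}_k∂)`.
[cite: BalabanImbrieJaffe1988, (2.20) p.262] -/
theorem eq220_of_526 (Qsst GAx cDk ds Qest d HAx Hk Dk D : R) (h531 : HAx = Qsst - GAx * ds * Qest * d)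
    (h221 : Eq221 HAx Hk d Dk) (h526 : GAx * ds - cDk * ds = d * D) :
    Eq220 Qsst cDk ds Qest d Hk (Dk + D * Qest * d) := by
  unfold Eq220
  unfold Eq221 at h221
  have hQ : Qsst = Hk + d * Dk + GAx * ds * Qest * d := by rw [← h221, h531, sub_add_cancel]
  have key : GAx * ds * Qest * d - cDk * ds * Qest * d = d * D * Qest * d := by
    rw [← sub_mul, ← sub_mul, h526]
  calc Qsst - cDk * ds * Qest * d
      = Hk + d * Dk + (GAx * ds * Qest * d - cDk * ds * Qest * d) := by rw [hQ]; abel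
    _ = Hk + d * (Dk + D * Qest * d) := by rw [key, mul_add d]; simp only [mul_assoc, add_assoc]

/-- **(2.20)** p. 262, verbatim: *"(Q^{s*}_k − 𝒟_k∂*Q^{e*}_k∂)A = H_kA + ∂C_kA. (2.20) … By changing gauge in each term in the
hierarchical sum defining 𝒟_k and applying (I.5.3.1), we obtain C_k = D_k + Σ_{j=0}^{k−1} D^{L^jη}_jC^{(j),L^jη}H^{*L^jη}_j∂*Q^{e*}_k∂.
(2.22)"* — PROVED with `C_k` = (2.22) `BIJ88Sect2Statements.cK D_k D C H* (∂*Q^{e*}_k∂) k`, from (I.5.3.1) `h531`, (2.21) `h221`,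
(I.5.2.6) `h526` and (I.5.2.7) `D = Σ_{j<k} D_jC^{(j)}H*_j∂*` (`h527`). [cite: BalabanImbrieJaffe1988, (2.20)–(2.22) p.262] -/
theorem eq220 (Qsst GAx cDk ds Qest d HAx Hk Dk D : R) (Dj C Hs : ℕ → R) (k : ℕ)
    (h531 : HAx = Qsst - GAx * ds * Qest * d) (h221 : Eq221 HAx Hk d Dk) (h526 : GAx * ds - cDk * ds = d * D)
    (h527 : D = curlyD Dj C (fun j => Hs j * ds) k) :
    Eq220 Qsst cDk ds Qest d Hk (cK Dk Dj C Hs (ds * Qest * d) k) := by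
  have h := eq220_of_526 Qsst GAx cDk ds Qest d HAx Hk Dk D h531 h221 h526
  have hD : D * Qest * d = curlyD Dj C (fun j => Hs j * (ds * Qest * d)) k := by
    rw [h527, mul_assoc, curlyD_mul_right]
    simp only [mul_assoc]
  unfold cK
  rw [← hD]
  exact h

/-- Conversely (2.20) DETERMINES the gradient part: two kernels `C_k`, `C′_k` satisfying (2.20) have `∂C_k = ∂C′_k`.
[cite: BalabanImbrieJaffe1988, (2.20) p.262] -/
theorem eq220_unique (Qsst cDk ds Qest d Hk Ck Ck' : R) (h : Eq220 Qsst cDk ds Qest d Hk Ck)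
    (h' : Eq220 Qsst cDk ds Qest d Hk Ck') : d * Ck = d * Ck' := by
  unfold Eq220 at h h'
  have := h.symm.trans h'
  exact add_left_cancel this

/-- (2.20) and (2.21) together say: the operator `Q^{s*}_k − 𝒟_k∂*Q^{e*}_k∂ − H_k` is a pure gauge transformation `∂C_k`, just as
`H_{k,Ax} − H_k = ∂D_k` is; their difference is the gauge transformation `∂(C_k − D_k) = (G_{k,Ax}∂* − 𝒟_k∂*)Q^{e*}_k∂` coming
from (I.5.3.1) (`h531`). [cite: BalabanImbrieJaffe1988, (2.20)–(2.21) p.262] -/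
theorem eq220_sub_eq221 (Qsst GAx cDk ds Qest d HAx Hk Dk Ck : R) (h531 : HAx = Qsst - GAx * ds * Qest * d)
    (h221 : Eq221 HAx Hk d Dk) (h220 : Eq220 Qsst cDk ds Qest d Hk Ck) :
    d * (Ck - Dk) = (GAx * ds - cDk * ds) * Qest * d := by
  unfold Eq220 at h220
  unfold Eq221 at h221
  have hQ : Qsst = Hk + d * Dk + GAx * ds * Qest * d := by rw [← h221, h531, sub_add_cancel]
  rw [hQ] at h220
  have h1 : d * Ck = d * Dk + (GAx * ds * Qest * d - cDk * ds * Qest * d) := by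
    have := h220
    apply add_left_cancel (a := Hk)
    rw [← this]
    abel
  rw [mul_sub, h1, sub_mul, sub_mul]
  abel

end RingLevel

/-! ## §2  (2.21) on the carrier of record of Proposition I.5.1.1 -/

/-- **(2.21) on `BIJ85Sect4Statements.GaugeRG`** (r15's carrier of Sects. I.4–I.5): with `D_kB := λ`, the gauge function (I.5.1.4)
(`GaugeRG.lam514`), Proposition I.5.1.1 (`GaugeRG.Prop511`: `H_{k,Ax}B − H_kB = ∂λ`) IS (2.21) `H_{k,Ax}B = H_kB + ∂D_kB`, for every
`B`. [cite: BalabanImbrieJaffe1988, (2.21) p.262] -/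
theorem eq221_gaugeRG (S : GaugeRG) (h511 : S.Prop511) (B : S.FieldU) :
    S.Hax B = S.H B + S.gradEta (S.mkGauge (S.lam514 B)) :=
  sub_eq_iff_eq_add'.mp (h511 B)

/-- … and conversely: (2.21) for every `B` with `D_kB = λ` of (I.5.1.4) is Proposition I.5.1.1. [cite: BalabanImbrieJaffe1988, (2.21) p.262] -/
theorem prop511_of_eq221 (S : GaugeRG) (h221 : ∀ B : S.FieldU, S.Hax B = S.H B + S.gradEta (S.mkGauge (S.lam514 B))) :
    S.Prop511 := fun B => sub_eq_iff_eq_add'.mpr (h221 B)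

end Literature.MathematicalPhysics.QuantumFieldTheory.BalabanImbrieJaffe1984to88.BIJ88Eq220Proof
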